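import Literature.Barriers.NavierStokesRegularity.SchefferSwitchedField
import Literature.Analysis.FluidPDE.ClassicalSolutionRescale
import Literature.Analysis.FluidPDE.NormalisedPressureAffine
import Literature.Analysis.FluidPDE.NormalisedPressureCompactSupport
import Literature.Analysis.FluidPDE.ClassicalNSILocalEnergy
import HarnessLib

/-!
# Scheffer's switched field: the rescaled pieces of a classical NSI block

Barrier-catalogue support file for `NavierStokesRegularity` (D-0021), part of the discharge of
`IsNSIBlock.switching` / `NSISwitching` (Scheffer 1985, Lemma 2.3; Ożański 2017, §2). For a
classical NSI block `(T, ν₀, τ, z, G, u)` (`IsNSIBlock`, `NavierStokesInequalitySwitching.lean`)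
the `j`-th rescaled piece `u^{(j)} = Scheffer.piece T τ z u j`
(`u^{(j)}(x,t) = τ^{-j} u(Γ^{-j}x, τ^{-2j}(t - t_j))`, `SchefferSwitchedField.lean`) is again a
classical solution of the Navier–Stokes inequality, on `[t_j, t_{j+1}]`:

* `isSmoothSpaceTimeOn_piece`, `contDiff_piece_slice`, `piece_apply_eq_zero`,
  `isDivFree_piece` — smooth on an open slab around `[t_j, t_{j+1}]`, slices `C^∞`, supported in
  `Γʲ(G) ⊆ G`, divergence free (Ożański 2017, (2.5));
* `normalisedPressure_piece` — its pressure function is the rescaled one,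
  `p̃[u^{(j)}(s)](x) = τ^{-2j} p̃[u(σ)](Γ^{-j}x)` (`NormalisedPressureAffine`);
* `nsi_piece` — **the pointwise Navier–Stokes inequality is scale covariant**: every term of
  `∂ₜ|u|² ≤ -u·∇(|u|² + 2p) + 2ν u·Δu` for `u^{(j)}` at `(s, x)` is `τ^{-4j}` times the
  corresponding term for `u` at `(σ, Γ^{-j}x)`, `σ = τ^{-2j}(s - t_j) ∈ [0,T]` (Ożański 2017, §2:
  "`u^{(1)}` satisfies the Navier–Stokes inequality on `ℝ³ × [T, (1+τ²)T]`");
* `norm_piece_succ_le` — **the drop at the switching times**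
  `|u^{(j+1)}(t_{j+1}, x)| ≤ |u^{(j)}(t_{j+1}, x)|` from the interior gain of magnitude
  (Ożański 2017, (2.6); Scheffer 1985, (2.33));
* `localEnergyIneq_piece` — the local energy inequality with boundary terms on `[t_j, t_{j+1}]`
  (the tree's `nsi_localEnergyIneq_Icc`, `ClassicalNSILocalEnergy.lean`), and the pressure class
  of the slices (`memLp_normalisedPressure_piece`, `poisson_normalisedPressure_piece`, from
  `NormalisedPressureCompactSupport.lean`).

## References

* W. S. Ożański, arXiv:1709.00602 (2017), §2 (2.4)–(2.6). [`Ozanski2017NSISingular`]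
* V. Scheffer, Comm. Math. Phys. 101 (1985), proof of Lemma 2.3, (2.32)–(2.33). [`Scheffer1985`]
-/

noncomputable section

open MeasureTheory Set Function Filter Topology TopologicalSpace Metric
open scoped ENNReal InnerProductSpace RealInnerProductSpace ContDiff Laplacian

namespace Literature.Barriers.NavierStokesRegularity

namespace IsNSIBlock

open Scheffer Literature.Analysis.FluidPDE

variable {T ν₀ τ : ℝ} {z : EuclideanSpace ℝ (Fin 3)} {G : Set (EuclideanSpace ℝ (Fin 3))}
  {u : ℝ → EuclideanSpace ℝ (Fin 3) → EuclideanSpace ℝ (Fin 3)}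

/-! ### Scalars -/

/-- `τ⁻¹ > 0`. [folklore] -/
theorem inv_tau_pos (h : IsNSIBlock T ν₀ τ z G u) : 0 < τ⁻¹ := inv_pos.2 h.τ_pos

/-- `τ^{-j} > 0`. [folklore] -/
theorem inv_tau_pow_pos (h : IsNSIBlock T ν₀ τ z G u) (n : ℕ) : 0 < (τ⁻¹) ^ n :=
  pow_pos h.inv_tau_pos n

/-- `τ^{-2j} = (τ^{-j})²`. [folklore] -/
theorem inv_tau_pow_two_mul (τ : ℝ) (j : ℕ) : (τ⁻¹) ^ (2 * j) = ((τ⁻¹) ^ j) ^ 2 := by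
  rw [← pow_mul, mul_comm]

/-- The local time `σ = -τ^{-2j}t_j + τ^{-2j}s = τ^{-2j}(s - t_j)` of the `j`-th piece lies in
`[0, T]` for `s ∈ [t_j, t_{j+1}]`. [folklore] -/
theorem localTime_mem (h : IsNSIBlock T ν₀ τ z G u) {j : ℕ} {s : ℝ}
    (hs : s ∈ Icc (switchTime T τ j) (switchTime T τ (j + 1))) :
    -((τ⁻¹) ^ (2 * j) * switchTime T τ j) + (τ⁻¹) ^ (2 * j) * s ∈ Icc 0 T := by
  have := localTime_mem_Icc (T := T) h.τ_pos hs
  convert this using 1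
  ring

/-! ### Smoothness, support and incompressibility of the pieces -/

/-- **The `j`-th piece is jointly smooth on an open slab around `[t_j, t_{j+1}]`** (pull-back of
the smoothness of `u` on `(-η, T+η) × ℝ³`). [cite: Ozanski2017NSISingular, §2 (2.4)] -/
theorem isSmoothSpaceTimeOn_piece (h : IsNSIBlock T ν₀ τ z G u) (j : ℕ) :
    ∃ η : ℝ, 0 < η ∧ IsSmoothSpaceTimeOn
      ((fun r => -((τ⁻¹) ^ (2 * j) * switchTime T τ j) + (τ⁻¹) ^ (2 * j) * r) ⁻¹' Ioo (-η) (T + η))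
      (piece T τ z u j) := by
  obtain ⟨η, hη, hs⟩ := h.smooth
  exact ⟨η, hη, hs.smul_stPull _ _ _ _ _⟩

/-- The slices `u^{(j)}(s)`, `s ∈ [t_j, t_{j+1}]`, are `C^∞`. [folklore] -/
theorem contDiff_piece_slice (h : IsNSIBlock T ν₀ τ z G u) {j : ℕ} {s : ℝ}
    (hs : s ∈ Icc (switchTime T τ j) (switchTime T τ (j + 1))) :
    ContDiff ℝ ∞ (piece T τ z u j s) := by
  have hσ := h.contDiff_slice (h.localTime_mem hs)
  exact (contDiff_stPull_slice (β := (τ⁻¹) ^ (2 * j)) (γ := (τ⁻¹) ^ j)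
    (x₀ := (1 - (τ⁻¹) ^ j) • (1 - τ)⁻¹ • z) hσ).const_smul ((τ⁻¹) ^ j)

/-- `Γ^{-j}x ∈ G` forces `x ∈ Γʲ(G) ⊆ G`. [cite: Ozanski2017NSISingular, §2 (2.5)] -/
theorem mem_of_inv_similarity_mem (h : IsNSIBlock T ν₀ τ z G u) {j : ℕ} {x : EuclideanSpace ℝ (Fin 3)}
    (hx : (1 - τ)⁻¹ • z + (τ⁻¹) ^ j • (x - (1 - τ)⁻¹ • z) ∈ G) : x ∈ G := by
  have h1 := h.mapsTo_iterate j hx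
  rwa [similarity_iterate_inv h.τ_pos.ne' h.τ_lt_one.ne] at h1

/-- **The pieces vanish off `G`**: `u^{(j)}(s, x) = 0` for `x ∉ G`, `s ∈ [t_j, t_{j+1}]`
(`supp u^{(j)}(s) = Γʲ(G) ⊆ G`, Ożański 2017, (2.5)). [cite: Ozanski2017NSISingular, §2 (2.5)] -/
theorem piece_apply_eq_zero (h : IsNSIBlock T ν₀ τ z G u) {j : ℕ} {s : ℝ}
    (hs : s ∈ Icc (switchTime T τ j) (switchTime T τ (j + 1))) {x : EuclideanSpace ℝ (Fin 3)}
    (hx : x ∉ G) : piece T τ z u j s x = 0 := by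
  rw [piece_apply]
  have hy : (1 - τ)⁻¹ • z + (τ⁻¹) ^ j • (x - (1 - τ)⁻¹ • z) ∉ G := fun hy =>
    hx (h.mem_of_inv_similarity_mem hy)
  have hσ : (τ⁻¹) ^ (2 * j) * (s - switchTime T τ j) ∈ Icc 0 T := localTime_mem_Icc h.τ_pos hs
  rw [← h.tsupport_eq _ hσ] at hy
  rw [image_eq_zero_of_notMem_tsupport hy, smul_zero]

/-- The slices of the pieces have topological support in `G`. [folklore] -/
theorem tsupport_piece_slice_subset (h : IsNSIBlock T ν₀ τ z G u) {j : ℕ} {s : ℝ}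
    (hs : s ∈ Icc (switchTime T τ j) (switchTime T τ (j + 1))) :
    tsupport (piece T τ z u j s) ⊆ G :=
  closure_minimal (fun x hx => by by_contra h'; exact hx (h.piece_apply_eq_zero hs h'))
    h.isCompact.isClosed

/-- The slices of the pieces have compact support. [folklore] -/
theorem hasCompactSupport_piece_slice (h : IsNSIBlock T ν₀ τ z G u) {j : ℕ} {s : ℝ}
    (hs : s ∈ Icc (switchTime T τ j) (switchTime T τ (j + 1))) :
    HasCompactSupport (piece T τ z u j s) :=
  h.isCompact.of_isClosed_subset (isClosed_tsupport _) (h.tsupport_piece_slice_subset hs)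

/-- **The pieces are divergence free** (chain rule). [cite: Ozanski2017NSISingular, §2 p. 6] -/
theorem isDivFree_piece (h : IsNSIBlock T ν₀ τ z G u) {j : ℕ} {s : ℝ}
    (hs : s ∈ Icc (switchTime T τ j) (switchTime T τ (j + 1))) :
    VectorCalculus.IsDivFree (piece T τ z u j s) := by
  intro x
  have hσ := h.localTime_mem hs
  have hu1 : ContDiff ℝ 1 (u (-((τ⁻¹) ^ (2 * j) * switchTime T τ j) + (τ⁻¹) ^ (2 * j) * s)) :=
    (h.contDiff_slice hσ).of_le (by norm_cast)
  have hd : DifferentiableAt ℝ (stPull ((τ⁻¹) ^ (2 * j)) ((τ⁻¹) ^ j)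
      (-((τ⁻¹) ^ (2 * j) * switchTime T τ j)) ((1 - (τ⁻¹) ^ j) • (1 - τ)⁻¹ • z) u s) x :=
    differentiable_stPull_slice (hu1.differentiable (by simp)) x
  rw [piece, show ((τ⁻¹) ^ j • stPull ((τ⁻¹) ^ (2 * j)) ((τ⁻¹) ^ j)
      (-((τ⁻¹) ^ (2 * j) * switchTime T τ j)) ((1 - (τ⁻¹) ^ j) • (1 - τ)⁻¹ • z) u) s =
      fun y => (τ⁻¹) ^ j • stPull ((τ⁻¹) ^ (2 * j)) ((τ⁻¹) ^ j)
        (-((τ⁻¹) ^ (2 * j) * switchTime T τ j)) ((1 - (τ⁻¹) ^ j) • (1 - τ)⁻¹ • z) u s y from rfl,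
    divergence_const_smul_apply hd, divergence_stPull, h.divFree _ hσ, mul_zero, mul_zero]

/-! ### The pressure function and the Navier–Stokes inequality of the pieces -/

/-- **The pressure function of a piece is the rescaled pressure function**:
`p̃[u^{(j)}(s)](x) = τ^{-2j} p̃[u(σ)](Γ^{-j}x)`, `σ` the local time (affine covariance of the
normalised pressure; Ożański 2017, §2; Scheffer 1985, p. 56: `pʲ⁺¹(x,t) = τ⁻²pʲ(τ⁻¹(x-a), …)`).
[cite: Ozanski2017NSISingular, §2 (2.4)] -/
theorem normalisedPressure_piece (h : IsNSIBlock T ν₀ τ z G u) (j : ℕ) (s : ℝ)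
    (x : EuclideanSpace ℝ (Fin 3)) :
    normalisedPressure (piece T τ z u j s) x = ((τ⁻¹) ^ j) ^ 2 *
      normalisedPressure (u (-((τ⁻¹) ^ (2 * j) * switchTime T τ j) + (τ⁻¹) ^ (2 * j) * s))
        ((1 - (τ⁻¹) ^ j) • (1 - τ)⁻¹ • z + (τ⁻¹) ^ j • x) := by
  have e : piece T τ z u j s = fun y => (τ⁻¹) ^ j •
      u (-((τ⁻¹) ^ (2 * j) * switchTime T τ j) + (τ⁻¹) ^ (2 * j) * s)
        ((1 - (τ⁻¹) ^ j) • (1 - τ)⁻¹ • z + (τ⁻¹) ^ j • y) := by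
    rw [piece_slice_eq_smul_comp_affine]
    funext y
    congr 2
    ring
  rw [e]
  exact normalisedPressure_smul_comp_affine _ _ _ (h.inv_tau_pow_pos j) x

/-- **Scale covariance of the pointwise Navier–Stokes inequality** (Ożański 2017, §2: the
rescaled copy `u^{(j)}` "satisfies the Navier–Stokes inequality on `ℝ³ × [t_j, t_{j+1}]`"). For
`ν ∈ [0, ν₀]`, `s ∈ [t_j, t_{j+1}]` and every `x`,
`∂ₜ|u^{(j)}|²(s,x) ≤ -u^{(j)}·∇(|u^{(j)}|² + 2p̃[u^{(j)}(s)])(x) + 2ν u^{(j)}·Δu^{(j)}(s,x)`: each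
term is `τ^{-4j}` times the corresponding term of the inequality for `u` at `(σ, Γ^{-j}x)`.
[cite: Ozanski2017NSISingular, §2 (2.4)] [cite: Scheffer1985, proof of Lemma 2.3 (2.32)] -/
theorem nsi_piece (h : IsNSIBlock T ν₀ τ z G u) {ν : ℝ} (hν : ν ∈ Icc 0 ν₀) {j : ℕ} {s : ℝ}
    (hs : s ∈ Icc (switchTime T τ j) (switchTime T τ (j + 1))) (x : EuclideanSpace ℝ (Fin 3)) :
    timeDeriv (fun r y => ‖piece T τ z u j r y‖ ^ 2) s x ≤
      -⟪piece T τ z u j s x, gradient (fun y => ‖piece T τ z u j s y‖ ^ 2 +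
          2 * normalisedPressure (piece T τ z u j s) y) x⟫ +
        2 * ν * ⟪piece T τ z u j s x, Δ (piece T τ z u j s) x⟫ := by
  -- abbreviations
  set α : ℝ := (τ⁻¹) ^ j with hα
  set β : ℝ := (τ⁻¹) ^ (2 * j) with hβ
  set t₀ : ℝ := -(β * switchTime T τ j) with ht₀
  set x₁ : EuclideanSpace ℝ (Fin 3) := (1 - α) • (1 - τ)⁻¹ • z with hx₁
  have hαpos : 0 < α := h.inv_tau_pow_pos j
  have hβpos : 0 < β := h.inv_tau_pow_pos _
  have hβα : β = α ^ 2 := inv_tau_pow_two_mul τ j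
  have hw : piece T τ z u j = α • stPull β α t₀ x₁ u := rfl
  set σ : ℝ := t₀ + β * s with hσdef
  set y : EuclideanSpace ℝ (Fin 3) := x₁ + α • x with hydef
  have hσ : σ ∈ Icc 0 T := h.localTime_mem hs
  -- the block inequality at `(σ, y)`
  have hblock := h.nsi ν hν σ hσ y
  -- regularity of the slice `u σ` and of its pressure
  have huσ : ContDiff ℝ ∞ (u σ) := h.contDiff_slice hσ
  have hu2 : ContDiff ℝ 2 (u σ) := huσ.of_le (by norm_cast)
  have huc : HasCompactSupport (u σ) := h.hasCompactSupport_slice hσ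
  have hp2 : ContDiff ℝ 2 (normalisedPressure (u σ)) :=
    contDiff_normalisedPressure_of_hasCompactSupport huσ huc
  set Q : EuclideanSpace ℝ (Fin 3) → ℝ := fun w => ‖u σ w‖ ^ 2 + 2 * normalisedPressure (u σ) w
    with hQdef
  have hQd : Differentiable ℝ Q :=
    ((hu2.differentiable (by norm_num)).norm_sq ℝ).add
      ((hp2.differentiable (by norm_num)).const_mul 2)
  -- (1) the time derivative of `|u^{(j)}|²`
  have e1 : (fun r w => ‖piece T τ z u j r w‖ ^ 2) =
      (α ^ 2) • stPull β α t₀ x₁ (fun r w => ‖u r w‖ ^ 2) := by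
    funext r w
    simp only [hw, smul_stPull_apply, smul_eq_mul, norm_smul, Real.norm_eq_abs, mul_pow, sq_abs]
  have hT : timeDeriv (fun r w => ‖piece T τ z u j r w‖ ^ 2) s x =
      (α ^ 2 * β) * timeDeriv (fun r w => ‖u r w‖ ^ 2) σ y := by
    rw [e1, timeDeriv_eq_timeDerivWithin_univ, timeDeriv_eq_timeDerivWithin_univ]
    have := timeDerivWithin_smul_stPull (univ : Set ℝ) (fun r w => ‖u r w‖ ^ 2) (α ^ 2)
      (β := β) hβpos.ne' α t₀ x₁ s x
    rw [preimage_univ] at this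
    rw [this, smul_eq_mul]
  -- (2) the gradient term
  have e2 : (fun w => ‖piece T τ z u j s w‖ ^ 2 + 2 * normalisedPressure (piece T τ z u j s) w) =
      fun w => (α ^ 2) • stPull β α t₀ x₁ (fun (_ : ℝ) w' => Q w') s w := by
    funext w
    rw [h.normalisedPressure_piece j s w]
    simp only [hw, smul_stPull_apply, stPull_apply, smul_eq_mul, norm_smul, Real.norm_eq_abs,
      mul_pow, sq_abs, hQdef]
    ring
  have hG : gradient (fun w => ‖piece T τ z u j s w‖ ^ 2 +
      2 * normalisedPressure (piece T τ z u j s) w) x = (α ^ 2 * α) • gradient Q y := by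
    rw [e2]
    have hd : DifferentiableAt ℝ (stPull β α t₀ x₁ (fun (_ : ℝ) w' => Q w') s) x :=
      differentiable_stPull_slice (u := fun (_ : ℝ) w' => Q w') hQd x
    rw [gradient_const_smul hd, gradient_stPull, smul_smul]
  -- (3) the Laplacian
  have hL : Δ (piece T τ z u j s) x = (α * α ^ 2) • Δ (u σ) y := by
    have hu2' : ContDiffAt ℝ 2 (stPull β α t₀ x₁ u s) x := (contDiff_stPull_slice hu2).contDiffAt
    rw [hw, show (α • stPull β α t₀ x₁ u) s = α • stPull β α t₀ x₁ u s from rfl,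
      InnerProductSpace.laplacian_smul α hu2', laplacian_stPull β α t₀ x₁ u s x hu2, smul_smul]
  -- (4) the value
  have hV : piece T τ z u j s x = α • u σ y := rfl
  -- assemble
  rw [hT, hG, hL, hV]
  simp only [inner_smul_left, inner_smul_right, RCLike.conj_to_real]
  have key : α ^ 2 * β * timeDeriv (fun r w => ‖u r w‖ ^ 2) σ y ≤
      α ^ 2 * β * (-⟪u σ y, gradient Q y⟫ + 2 * ν * ⟪u σ y, Δ (u σ) y⟫) :=
    mul_le_mul_of_nonneg_left hblock (mul_nonneg (pow_nonneg hαpos.le 2) hβpos.le)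
  have e3 : α ^ 2 * β * (-⟪u σ y, gradient Q y⟫ + 2 * ν * ⟪u σ y, Δ (u σ) y⟫) =
      -(α ^ 2 * α * (α * ⟪u σ y, gradient Q y⟫)) + 2 * ν * (α * α ^ 2 * (α * ⟪u σ y, Δ (u σ) y⟫)) := by
    rw [hβα]; ring
  rw [e3] at key
  exact key

/-! ### The drop at the switching times -/

/-- **The magnitude drops at the switching times**: `|u^{(j+1)}(t_{j+1}, x)| ≤ |u^{(j)}(t_{j+1}, x)|`
(Ożański 2017, (2.6), from the interior gain of magnitude (2.2); Scheffer 1985, (2.33)): with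
`y = Γ^{-(j+1)}x`, `Γ(y) = Γ^{-j}x`, and the gain `τ⁻¹|u(y,0)| ≤ |u(Γ(y),T)|` rescaled by `τ^{-j}`.
[cite: Ozanski2017NSISingular, §2 (2.6)] [cite: Scheffer1985, proof of Lemma 2.3 (2.33)] -/
theorem norm_piece_succ_le (h : IsNSIBlock T ν₀ τ z G u) (j : ℕ) (x : EuclideanSpace ℝ (Fin 3)) :
    ‖piece T τ z u (j + 1) (switchTime T τ (j + 1)) x‖ ≤
      ‖piece T τ z u j (switchTime T τ (j + 1)) x‖ := by
  have hτ0 : τ ≠ 0 := h.τ_pos.ne'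
  rw [piece_apply_switchTime, piece_apply_switchTime_succ T hτ0]
  set y : EuclideanSpace ℝ (Fin 3) := (1 - τ)⁻¹ • z + (τ⁻¹) ^ (j + 1) • (x - (1 - τ)⁻¹ • z) with hy
  have hcoef : τ * (τ⁻¹) ^ (j + 1) = (τ⁻¹) ^ j := by
    rw [pow_succ, mul_comm, mul_assoc, inv_mul_cancel₀ hτ0, mul_one]
  have hfix := smul_blowupPoint_add h.τ_lt_one.ne z
  simp only [blowupPoint] at hfix
  have hfix' : τ • ((1 - τ)⁻¹ • z) = (1 - τ)⁻¹ • z - z := eq_sub_of_add_eq hfix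
  have hΓ : τ • y + z = (1 - τ)⁻¹ • z + (τ⁻¹) ^ j • (x - (1 - τ)⁻¹ • z) := by
    rw [hy, smul_add, hfix', smul_smul, hcoef]
    abel
  have hgain := h.gain y
  rw [hΓ] at hgain
  rw [norm_smul, norm_smul, Real.norm_of_nonneg (h.inv_tau_pow_pos _).le,
    Real.norm_of_nonneg (h.inv_tau_pow_pos _).le, pow_succ, mul_assoc]
  exact mul_le_mul_of_nonneg_left hgain (h.inv_tau_pow_pos j).le

/-! ### The local energy inequality with boundary terms, and the pressure class, of the pieces -/

/-- Joint continuity of `(s, x) ↦ p̃[u^{(j)}(s)](x)` on `[t_j, t_{j+1}] × ℝ³`. [folklore] -/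
theorem continuousOn_normalisedPressure_piece (h : IsNSIBlock T ν₀ τ z G u) (j : ℕ) :
    ContinuousOn (fun q : ℝ × EuclideanSpace ℝ (Fin 3) => normalisedPressure (piece T τ z u j q.1) q.2)
      (Icc (switchTime T τ j) (switchTime T τ (j + 1)) ×ˢ univ) := by
  obtain ⟨η, hη, hsm⟩ := h.isSmoothSpaceTimeOn_piece j
  have hlt : switchTime T τ j < switchTime T τ (j + 1) :=
    strictMono_switchTime h.T_pos h.τ_pos (Nat.lt_succ_self j)
  exact continuousOn_normalisedPressure_slice
    (hsm.mono (Icc_switchTime_subset_preimage h.τ_pos hη j)) (uniqueDiffOn_Icc hlt) h.isCompact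
    fun s hs x hx => h.piece_apply_eq_zero hs hx

/-- **The local energy inequality with boundary terms for the `j`-th piece on `[t_j, t_{j+1}]`**,
for every `ν ∈ [0, ν₀]` and every nonnegative space–time test function (the tree's
`nsi_localEnergyIneq_Icc` for classical NSI solutions; Ożański 2017, (1.6); Scheffer 1985,
(2.32)). [cite: Ozanski2017NSISingular, §2 p. 7] [cite: Scheffer1985, proof of Lemma 2.3 (2.32)] -/
theorem localEnergyIneq_piece (h : IsNSIBlock T ν₀ τ z G u) {ν : ℝ} (hν : ν ∈ Icc 0 ν₀) (j : ℕ)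
    {φ : ℝ → EuclideanSpace ℝ (Fin 3) → ℝ}
    (hφ : IsSpaceTimeTestOn (⊤ : Opens (ℝ × EuclideanSpace ℝ (Fin 3))) φ) (hφ0 : ∀ s x, 0 ≤ φ s x) :
    (∫ x, ‖piece T τ z u j (switchTime T τ (j + 1)) x‖ ^ 2 * φ (switchTime T τ (j + 1)) x) -
        (∫ x, ‖piece T τ z u j (switchTime T τ j) x‖ ^ 2 * φ (switchTime T τ j) x) +
        2 * ν * ∫ s in Ioo (switchTime T τ j) (switchTime T τ (j + 1)), ∫ x,
          frobeniusNormSq (fderiv ℝ (piece T τ z u j s) x) * φ s x ≤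
      ∫ s in Ioo (switchTime T τ j) (switchTime T τ (j + 1)), ∫ x,
        (‖piece T τ z u j s x‖ ^ 2 * (timeDeriv φ s x + ν * Δ (φ s) x) +
          (‖piece T τ z u j s x‖ ^ 2 + 2 * normalisedPressure (piece T τ z u j s) x) *
            ⟪piece T τ z u j s x, gradient (φ s) x⟫) := by
  obtain ⟨η, hη, hsm⟩ := h.isSmoothSpaceTimeOn_piece j
  have hlt : switchTime T τ j < switchTime T τ (j + 1) :=
    strictMono_switchTime h.T_pos h.τ_pos (Nat.lt_succ_self j)
  have hopen : IsOpen ((fun r => -((τ⁻¹) ^ (2 * j) * switchTime T τ j) + (τ⁻¹) ^ (2 * j) * r) ⁻¹'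
      Ioo (-η) (T + η)) := isOpen_Ioo.preimage (by fun_prop)
  exact nsi_localEnergyIneq_Icc hlt.le hopen (Icc_switchTime_subset_preimage h.τ_pos hη j) hsm
    h.isCompact (fun s hs x hx => h.piece_apply_eq_zero hs hx) (fun s hs => h.isDivFree_piece hs)
    (fun s hs => (contDiff_normalisedPressure_of_hasCompactSupport (h.contDiff_piece_slice hs)
      (h.hasCompactSupport_piece_slice hs)).of_le one_le_two)
    (h.continuousOn_normalisedPressure_piece j) (fun s hs x => h.nsi_piece hν hs x) hφ hφ0

/-- The pressure slices of the pieces are in `L^{3/2}(ℝ³)`. [cite: Ozanski2019NSI, Def. 1.1] -/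
theorem memLp_normalisedPressure_piece (h : IsNSIBlock T ν₀ τ z G u) {j : ℕ} {s : ℝ}
    (hs : s ∈ Icc (switchTime T τ j) (switchTime T τ (j + 1))) :
    MemLp (normalisedPressure (piece T τ z u j s)) (3 / 2 : ℝ≥0∞) volume :=
  memLp_normalisedPressure_three_halves (h.contDiff_piece_slice hs) (h.hasCompactSupport_piece_slice hs)

/-- The pressure slices of the pieces solve the pressure Poisson equation weakly.
[cite: Ozanski2019NSI, Def. 1.1 (1.1)] -/
theorem poisson_normalisedPressure_piece (h : IsNSIBlock T ν₀ τ z G u) {j : ℕ} {s : ℝ}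
    (hs : s ∈ Icc (switchTime T τ j) (switchTime T τ (j + 1)))
    {ψ : EuclideanSpace ℝ (Fin 3) → ℝ}
    (hψ : Literature.Analysis.FunctionSpaces.IsTestFunctionOn (⊤ : Opens (EuclideanSpace ℝ (Fin 3))) ψ) :
    -∫ x, normalisedPressure (piece T τ z u j s) x * Δ ψ x =
      ∫ x, fderiv ℝ (fderiv ℝ ψ) x (piece T τ z u j s x) (piece T τ z u j s x) :=
  integral_normalisedPressure_mul_laplacian (h.contDiff_piece_slice hs)
    (h.hasCompactSupport_piece_slice hs) (hψ.contDiff.of_le (by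
      change ((2 : ℕ∞) : WithTop ℕ∞) ≤ ((⊤ : ℕ∞) : WithTop ℕ∞)
      exact_mod_cast le_top))
    hψ.hasCompactSupport

end IsNSIBlock

end Literature.Barriers.NavierStokesRegularity

end
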